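import Summits.MatrixMultiplication.OmegaCensus.STPPVosperSlackOneSteps
import Summits.MatrixMultiplication.OmegaCensus.STPPVosperTilingTools

/-!
# ω-census (abelian STPP census): the A-PAIRING of the block sum-set `W` — an exact-cover test modulo `p` and its soundness (kernel)

HONEST FRAMING (pub-omega census; verbatim): lottery ticket; floor = certified bounds/negative ranges.
Census STRUCTURE (seat pub-omega-stpp-2 gen 26, 2026-08-28), family (b2).  In every case of the slack-1 Vosper law (`STPPVosperSlackOneLaw*.lean`,
`STPPVosperSlackOneCoverLawA2*.lean`) the set `W = {c − a − b : (a,b,c) ∈ Aᵢ × Bᵢ × Cᵢ}` (`vol` distinct sums, Def. 5.1 pattern `(i,i,i)`) is the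
complement of `−Aᵢ + Y°` in the progression `V`; the window tables only use that `W`, transported into `{0,…,N₁−1}`, is a disjoint union of translates of
the `B`-pattern (`b`-runs; tiles of `[0,b] ∖ {g}` in case β).  But `W = Cᵢ + (−Aᵢ) − Bᵢ`, so `W` is in fact a disjoint union of `|Cᵢ|` translates of the
COMBINED pattern `u·(−Aᵢ) − u·Bᵢ = {ε·j − δ}` (`−Aᵢ` an `a`-progression of ratio `j` after transport, `δ` over the `B`-pattern) — for `a = 2`: the anchors of
the `B`-tiling pair up at distance `j`.  This file provides
* `patN p j a BD` — the combined pattern as residues, `coverByF p T fuel X` — an exact-cover test of a finite set of residues by translates of `T`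
  modulo `p` (branching over the tile through the minimum; `Bool`), and its soundness `coverByF_of_tiling`;
* the transport `coverByF_blockSum`: for an STPP family whose block `i` has `−Aᵢ = {s₀ + ε d}` and `Bᵢ = {β + δ e′ : δ ∈ BD}`, the image of `W` under
  `x ↦ (u(x) + w).val` (`u e′ = 1`) passes `coverByF` with the pattern `patN p (u d).val a BD` — UNCONDITIONAL, no table hypothesis;
* the identifications `image_val_apFinset'`, `image_val_eq_filter`, `image_val_eq_erase_filter` of transported sets with the `ℕ`-sets of the tables.
The laws with the pairing premise (`…CoverLawA2P.lean`) add `coverByF … = true` to each table hypothesis; python (HOME `pub-omega-stpp-2-g26/code/wtile2.py`):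
the premise alone empties the K3 tables at `61` and removes the survivors `29, 30` of `{(2,3,5),(3,2,5)} @ 59`.  Nothing here is progress on `ω`.

References: H. Cohn, R. Kleinberg, B. Szegedy, C. Umans, FOCS 2005 (arXiv:math/0511460), Def. 5.1; A. G. Vosper, J. London Math. Soc. 31 (1956).
-/

open Finset
open scoped Pointwise

namespace Summit.MatrixMultiplication.OmegaCensus.CubeNB

open Literature.Computability.AlgebraicComplexity
open Literature.Combinatorics.Additive
open Summit.MatrixMultiplication.OmegaCensus.STPPKneser

/-! ## §1 The exact-cover test modulo `p` -/

section CoverBy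

/-- The combined `(A,B)`-pattern as residues: `{(ε·j − δ) mod p : ε < a, δ ∈ BD}`. [folklore] -/
def patN (p j a : ℕ) (BD : Finset ℕ) : Finset ℕ := ((range a) ×ˢ BD).image fun εδ : ℕ × ℕ => ((εδ.1 * j) % p + p - εδ.2) % p

/-- **Exact-cover test modulo `p`.**  `coverByF p T fuel X`: is the finite set of residues `X` a disjoint union of (at most `fuel`) translates
`(g + T) mod p`?  The minimum of `X` lies in some tile; branch over its position in the pattern. (`Bool`.) [folklore] -/
def coverByF (p : ℕ) (T : Finset ℕ) : ℕ → Finset ℕ → Bool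
  | 0, X => decide (X = ∅)
  | fuel + 1, X =>
    if h : X.Nonempty then
      decide (∃ g ∈ T, T.image (fun t => ((X.min' h + p - g) % p + t) % p) ⊆ X ∧
        coverByF p T fuel (X \ T.image fun t => ((X.min' h + p - g) % p + t) % p) = true)
    else true

/-- `coverByF` accepts the empty set. [folklore] -/
theorem coverByF_empty (p : ℕ) (T : Finset ℕ) (fuel : ℕ) : coverByF p T fuel ∅ = true := by
  cases fuel with
  | zero => simp [coverByF]
  | succ f => simp [coverByF]

/-- **Soundness of the exact-cover test.**  If `X = ⋃_{k ∈ s} ((g k + T) mod p)` with PAIRWISE DISJOINT tiles, `g k < p`, every `t ∈ T` below `p` and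
`#s ≤ fuel`, then `coverByF p T fuel X = true`. [folklore] -/
theorem coverByF_of_tiling (p : ℕ) (T : Finset ℕ) (hT : ∀ t ∈ T, t < p) {ι : Type*} [DecidableEq ι] (g : ι → ℕ) :
    ∀ (fuel : ℕ) (s : Finset ι), #s ≤ fuel → (∀ k ∈ s, g k < p) → (s : Set ι).PairwiseDisjoint (fun k => T.image fun t => (g k + t) % p) →
      coverByF p T fuel (s.biUnion fun k => T.image fun t => (g k + t) % p) = true := by
  intro fuel
  induction fuel with
  | zero =>
    intro s hs _ _
    rw [Finset.card_eq_zero.1 (Nat.le_zero.1 hs), Finset.biUnion_empty]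
    simp [coverByF]
  | succ f ih =>
    intro s hs hg hdisj
    set X := s.biUnion fun k => T.image fun t => (g k + t) % p with hX
    by_cases hne : X.Nonempty
    · rw [coverByF, dif_pos hne, decide_eq_true_eq]
      set x₀ := X.min' hne with hx₀
      have hx₀mem : x₀ ∈ X := Finset.min'_mem X hne
      obtain ⟨k₀, hk₀, hx₀k⟩ := Finset.mem_biUnion.1 hx₀mem
      obtain ⟨t₀, ht₀, hx₀t⟩ := Finset.mem_image.1 hx₀k
      have hgk₀ : g k₀ < p := hg k₀ hk₀
      have ht₀p : t₀ < p := hT t₀ ht₀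
      have hctr : (x₀ + p - t₀) % p = g k₀ := by
        rw [← hx₀t]
        have h1 : (g k₀ + t₀) % p + p - t₀ = (g k₀ + t₀) % p + (p - t₀) := by omega
        rw [h1, Nat.add_mod, Nat.mod_mod, ← Nat.add_mod, show g k₀ + t₀ + (p - t₀) = g k₀ + p by omega, Nat.add_mod_right,
          Nat.mod_eq_of_lt hgk₀]
      refine ⟨t₀, ht₀, ?_, ?_⟩
      · rw [hctr]
        exact Finset.subset_biUnion_of_mem (fun k => T.image fun t => (g k + t) % p) hk₀
      · have hrest : X \ T.image (fun t => ((x₀ + p - t₀) % p + t) % p) = (s.erase k₀).biUnion fun k => T.image fun t => (g k + t) % p := by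
          rw [hctr, hX, ← Finset.insert_erase hk₀, Finset.biUnion_insert, Finset.insert_erase hk₀]
          rw [Finset.union_sdiff_left, Finset.sdiff_eq_self_iff_disjoint]
          rw [Finset.disjoint_biUnion_left]
          intro k hk
          have hkne : k ≠ k₀ := Finset.ne_of_mem_erase hk
          exact hdisj (Finset.mem_coe.2 (Finset.mem_of_mem_erase hk)) (Finset.mem_coe.2 hk₀) hkne
        rw [hrest]
        apply ih
        · rw [Finset.card_erase_of_mem hk₀]; omega
        · exact fun k hk => hg k (Finset.mem_of_mem_erase hk)
        · exact hdisj.subset (Finset.coe_subset.2 (Finset.erase_subset k₀ s))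
    · rw [coverByF, dif_neg hne]

end CoverBy

/-! ## §2 Transport from `ℤ/pℤ` -/

section Transport

variable {p : ℕ} [hp : Fact p.Prime]

/-- Values of a translate: `((g + τ).val)_{τ ∈ G} = ((g.val + t) mod p)_{t ∈ G.val}`. [folklore] -/
theorem image_val_translate (G : Finset (ZMod p)) (g : ZMod p) :
    (G.image fun τ => g + τ).image ZMod.val = (G.image ZMod.val).image fun t => (g.val + t) % p := by
  rw [Finset.image_image, Finset.image_image]
  refine Finset.image_congr fun τ _ => ?_
  simp only [Function.comp_apply]
  exact ZMod.val_add g τ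

/-- **Transport of a tiling in `ℤ/pℤ` to the exact-cover test.**  If a family of translates `gz k + TZ` (`k ∈ s`) is pairwise disjoint and `#s ≤ fuel`,
then the values of its union pass `coverByF` with the pattern `TZ.image val`. [folklore] -/
theorem coverByF_of_zmod_tiling (TZ : Finset (ZMod p)) {ι : Type*} [DecidableEq ι] (s : Finset ι) (gz : ι → ZMod p) {fuel : ℕ}
    (hfuel : #s ≤ fuel) (hdisj : (s : Set ι).PairwiseDisjoint fun k => TZ.image fun τ => gz k + τ) :
    coverByF p (TZ.image ZMod.val) fuel ((s.biUnion fun k => TZ.image fun τ => gz k + τ).image ZMod.val) = true := by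
  have himg : (s.biUnion fun k => TZ.image fun τ => gz k + τ).image ZMod.val =
      s.biUnion fun k => (TZ.image ZMod.val).image fun t => ((gz k).val + t) % p := by
    rw [Finset.biUnion_image]
    exact Finset.biUnion_congr rfl fun k _ => image_val_translate TZ (gz k)
  rw [himg]
  refine coverByF_of_tiling p (TZ.image ZMod.val) (fun t ht => ?_) (fun k => (gz k).val) fuel s hfuel (fun k _ => ZMod.val_lt _) ?_
  · obtain ⟨τ, -, rfl⟩ := Finset.mem_image.1 ht
    exact ZMod.val_lt τ
  · intro k hk k' hk' hne
    have h := hdisj hk hk' hne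
    rw [Function.onFun] at h ⊢
    rw [← image_val_translate, ← image_val_translate]
    exact (Finset.disjoint_image (ZMod.val_injective p)).2 h

variable {N : ℕ} {A B C : Fin N → Finset (ZMod p)}

/-- **`W` by the third coordinate.**  The block sum-set `W = {c − a − b}` is the union over `c ∈ Cᵢ` of the sets `c − Aᵢ − Bᵢ`, and these are pairwise
disjoint (all `|Aᵢ||Bᵢ||Cᵢ|` sums are distinct, Def. 5.1 pattern `(i,i,i)`). [cite: CohnKleinbergSzegedyUmans2005, Def. 5.1] -/
theorem W_eq_biUnion_C (hS : IsSTPP A B C) (i : Fin N) :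
    (((A i) ×ˢ ((B i) ×ˢ (C i))).image fun q : ZMod p × ZMod p × ZMod p => (0 : ZMod p) + q.2.2 - q.1 - q.2.1) =
      (C i).biUnion (fun c => ((A i) ×ˢ (B i)).image fun ab : ZMod p × ZMod p => (0 : ZMod p) + c - ab.1 - ab.2) ∧
    ((C i : Finset (ZMod p)) : Set (ZMod p)).PairwiseDisjoint
      (fun c => ((A i) ×ˢ (B i)).image fun ab : ZMod p × ZMod p => (0 : ZMod p) + c - ab.1 - ab.2) := by
  constructor
  · ext x
    simp only [Finset.mem_image, Finset.mem_product, Finset.mem_biUnion, Prod.exists]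
    constructor
    · rintro ⟨a, b, c, ⟨ha, hb, hc⟩, rfl⟩
      exact ⟨c, hc, a, b, ⟨ha, hb⟩, rfl⟩
    · rintro ⟨c, hc, a, b, ⟨ha, hb⟩, rfl⟩
      exact ⟨a, b, c, ⟨ha, hb, hc⟩, rfl⟩
  · intro c hc c' hc' hne
    rw [Function.onFun, Finset.disjoint_left]
    intro x hx hx'
    obtain ⟨⟨a, b⟩, hab, rfl⟩ := Finset.mem_image.1 hx
    obtain ⟨⟨a', b'⟩, hab', heq⟩ := Finset.mem_image.1 hx'
    have h1 := Finset.mem_product.1 hab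
    have h2 := Finset.mem_product.1 hab'
    have hrel : (a' - a) + (b' - b) + (c - c') = 0 := by
      have h : (0 : ZMod p) + c' - a' - b' = 0 + c - a - b := heq
      linear_combination (-1 : ZMod p) * h
    obtain ⟨-, -, -, -, h5⟩ := hS i i i a h1.1 a' h2.1 b h1.2 b' h2.2 c' (Finset.mem_coe.1 hc') c (Finset.mem_coe.1 hc) hrel
    exact hne h5.symm

/-- **Transport of one `C`-tile.**  With `−Aᵢ = {s₀ + ε•d : ε < a}`, `Bᵢ = {β + δ•e′ : δ ∈ BD}` and `u e′ = 1`: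
`u·(c − Aᵢ − Bᵢ) + w = (u c + w + u s₀ − u β) + {ε·(u d) − δ}`. [folklore] -/
theorem image_Ctile_affine (i : Fin N) {u e' d s₀ β w : ZMod p} (hue : u * e' = 1) {a : ℕ}
    (hSn : (A i).image (fun x => (0 : ZMod p) - x) = apFinset s₀ d a) {BD : Finset ℕ} (hB : B i = BD.image fun δ : ℕ => β + δ • e')
    (c : ZMod p) :
    (((A i) ×ˢ (B i)).image fun ab : ZMod p × ZMod p => (0 : ZMod p) + c - ab.1 - ab.2).image (fun x => u * x + w) =
      (((range a) ×ˢ BD).image fun εδ : ℕ × ℕ => (εδ.1 : ZMod p) * (u * d) - (εδ.2 : ZMod p)).image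
        fun τ => (u * c + w + u * s₀ - u * β) + τ := by
  ext x
  simp only [Finset.mem_image, Finset.mem_product, Prod.exists, Finset.mem_range]
  constructor
  · rintro ⟨y, ⟨a', b', ⟨ha', hb'⟩, rfl⟩, rfl⟩
    have hs : (0 : ZMod p) - a' ∈ apFinset s₀ d a := by rw [← hSn]; exact Finset.mem_image.2 ⟨a', ha', rfl⟩
    obtain ⟨ε, hε, hεs⟩ := mem_apFinset.1 hs
    rw [hB] at hb'
    obtain ⟨δ, hδ, rfl⟩ := Finset.mem_image.1 hb'
    refine ⟨(ε : ZMod p) * (u * d) - (δ : ZMod p), ⟨ε, δ, ⟨hε, hδ⟩, rfl⟩, ?_⟩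
    have h1 : (0 : ZMod p) - a' = s₀ + ε • d := hεs.symm
    rw [nsmul_eq_mul] at h1
    rw [nsmul_eq_mul]
    linear_combination (-u) * h1 + (δ : ZMod p) * hue
  · rintro ⟨τ, ⟨ε, δ, ⟨hε, hδ⟩, rfl⟩, rfl⟩
    have hs : s₀ + ε • d ∈ (A i).image (fun x => (0 : ZMod p) - x) := by rw [hSn]; exact mem_apFinset.2 ⟨ε, hε, rfl⟩
    obtain ⟨a', ha', ha's⟩ := Finset.mem_image.1 hs
    refine ⟨(0 : ZMod p) + c - a' - (β + δ • e'), ⟨a', β + δ • e', ⟨ha', by rw [hB]; exact Finset.mem_image.2 ⟨δ, hδ, rfl⟩⟩, rfl⟩, ?_⟩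
    have h1 : (0 : ZMod p) - a' = s₀ + ε • d := ha's
    rw [nsmul_eq_mul] at h1
    rw [nsmul_eq_mul]
    linear_combination u * h1 - (δ : ZMod p) * hue

/-- Values of the combined pattern: `{(ε·(u d) − δ).val} = patN p (u d).val a BD` for `a ≤ p` and `BD` below `p`. [folklore] -/
theorem image_val_pattern {u d : ZMod p} {a : ℕ} (ha : a ≤ p) {BD : Finset ℕ} (hBD : ∀ δ ∈ BD, δ < p) :
    (((range a) ×ˢ BD).image fun εδ : ℕ × ℕ => (εδ.1 : ZMod p) * (u * d) - (εδ.2 : ZMod p)).image ZMod.val = patN p (u * d).val a BD := by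
  rw [patN, Finset.image_image]
  refine Finset.image_congr fun εδ hεδ => ?_
  obtain ⟨hε, hδ⟩ := Finset.mem_product.1 (Finset.mem_coe.1 hεδ)
  rw [Finset.mem_range] at hε
  simp only [Function.comp_apply]
  rw [val_sub_eq_mod, ZMod.val_mul, ZMod.val_natCast, ZMod.val_natCast, Nat.mod_eq_of_lt (by omega : εδ.1 < p),
    Nat.mod_eq_of_lt (hBD _ hδ)]

/-- **The A-pairing of `W` (transported).**  For an STPP family and a block `i` with `−Aᵢ = {s₀ + ε•d : ε < a}` (`a ≤ p`), `Bᵢ = {β + δ•e′ : δ ∈ BD}`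
(`BD` below `p`), `u e′ = 1` and `#Cᵢ ≤ fuel`: the values of `u·W + w` pass the exact-cover test with the pattern `patN p (u d).val a BD`.
[cite: CohnKleinbergSzegedyUmans2005, Def. 5.1] -/
theorem coverByF_blockSum (hS : IsSTPP A B C) (i : Fin N) {u e' d s₀ β w : ZMod p} (hue : u * e' = 1) {a : ℕ} (ha : a ≤ p)
    (hSn : (A i).image (fun x => (0 : ZMod p) - x) = apFinset s₀ d a) {BD : Finset ℕ} (hBD : ∀ δ ∈ BD, δ < p)
    (hB : B i = BD.image fun δ : ℕ => β + δ • e') {fuel : ℕ} (hfuel : #(C i) ≤ fuel) :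
    coverByF p (patN p (u * d).val a BD) fuel
      (((((A i) ×ˢ ((B i) ×ˢ (C i))).image fun q : ZMod p × ZMod p × ZMod p => (0 : ZMod p) + q.2.2 - q.1 - q.2.1).image
        fun x => u * x + w).image ZMod.val) = true := by
  obtain ⟨hWeq, hdisj⟩ := W_eq_biUnion_C hS i
  set TZ := ((range a) ×ˢ BD).image fun εδ : ℕ × ℕ => (εδ.1 : ZMod p) * (u * d) - (εδ.2 : ZMod p) with hTZ
  set gz : ZMod p → ZMod p := fun c => u * c + w + u * s₀ - u * β with hgz
  have htiles : (((A i) ×ˢ ((B i) ×ˢ (C i))).image fun q : ZMod p × ZMod p × ZMod p => (0 : ZMod p) + q.2.2 - q.1 - q.2.1).image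
      (fun x => u * x + w) = (C i).biUnion fun c => TZ.image fun τ => gz c + τ := by
    rw [hWeq, Finset.biUnion_image]
    exact Finset.biUnion_congr rfl fun c _ => image_Ctile_affine i hue hSn hB c
  have hφinj : Function.Injective (fun x : ZMod p => u * x + w) := by
    have hu0 : u ≠ 0 := fun h => by rw [h, zero_mul] at hue; exact zero_ne_one hue
    exact affine_injective hu0 w
  have hdisjT : ((C i : Finset (ZMod p)) : Set (ZMod p)).PairwiseDisjoint fun c => TZ.image fun τ => gz c + τ := by
    intro c hc c' hc' hne
    rw [Function.onFun, ← image_Ctile_affine i hue hSn hB c, ← image_Ctile_affine i hue hSn hB c']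
    exact (Finset.disjoint_image hφinj).2 (hdisj hc hc' hne)
  rw [htiles, ← image_val_pattern ha hBD]
  exact coverByF_of_zmod_tiling TZ (C i) gz hfuel hdisjT

/-! ### Identification with the `ℕ`-sets of the tables -/

/-- Values of a progression: `(apFinset t j m).val = {(t.val + j.val·k) mod p : k < m}`. [folklore] -/
theorem image_val_apFinset' (t j : ZMod p) (m : ℕ) :
    (apFinset t j m).image ZMod.val = (range m).image fun k => (t.val + j.val * k) % p := by
  have himg : apFinset t j m = (range m).image fun k : ℕ => t + k • j := rfl
  rw [himg, Finset.image_image]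
  exact Finset.image_congr fun k _ => val_add_nsmul_zmod t j k

/-- **Window minus positions.**  If `T ⊔ S` is the window `{0,…,N₁−1}` (`N₁ ≤ p`) and `S.val = POS`, then `T.val = {x < N₁ : x ∉ POS}`. [folklore] -/
theorem image_val_eq_filter {N₁ : ℕ} (hN : N₁ ≤ p) {T S : Finset (ZMod p)} (hTS : Disjoint T S) (hV : T ∪ S = apFinset (0 : ZMod p) 1 N₁)
    {POS : Finset ℕ} (hPOS : S.image ZMod.val = POS) : T.image ZMod.val = (range N₁).filter fun x => x ∉ POS := by
  ext x
  simp only [Finset.mem_image, Finset.mem_filter, Finset.mem_range]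
  constructor
  · rintro ⟨y, hyT, rfl⟩
    have hyI : y ∈ apFinset (0 : ZMod p) 1 N₁ := by rw [← hV]; exact Finset.mem_union_left _ hyT
    refine ⟨(mem_apFinset_zero_one_iff hN).1 hyI, fun hmem => ?_⟩
    rw [← hPOS] at hmem
    obtain ⟨y', hy'S, hyy⟩ := Finset.mem_image.1 hmem
    have : y' = y := ZMod.val_injective p hyy
    exact Finset.disjoint_left.1 hTS hyT (this ▸ hy'S)
  · rintro ⟨hlt, hnot⟩
    have hxp : x < p := by omega
    have hxval : (x : ZMod p).val = x := by rw [ZMod.val_natCast, Nat.mod_eq_of_lt hxp]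
    have hxI : (x : ZMod p) ∈ apFinset (0 : ZMod p) 1 N₁ := (mem_apFinset_zero_one_iff hN).2 (by rw [hxval]; exact hlt)
    rw [← hV, Finset.mem_union] at hxI
    rcases hxI with hxT | hxS
    · exact ⟨(x : ZMod p), hxT, hxval⟩
    · exact absurd (by rw [← hPOS]; exact Finset.mem_image.2 ⟨_, hxS, hxval⟩) hnot

/-- **Holed window minus positions.**  If `T ⊔ S` is the window `{0,…,N₁−1}` minus the point `h₀` (`N₁ ≤ p`) and `S.val = POS`, then
`T.val = {x < N₁ : x ≠ h₀.val, x ∉ POS}`. [folklore] -/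
theorem image_val_eq_erase_filter {N₁ : ℕ} (hN : N₁ ≤ p) {T S : Finset (ZMod p)} (hTS : Disjoint T S) {h₀ : ZMod p}
    (hV : T ∪ S = (apFinset (0 : ZMod p) 1 N₁).erase h₀) {POS : Finset ℕ} (hPOS : S.image ZMod.val = POS) :
    T.image ZMod.val = ((range N₁).erase h₀.val).filter fun x => x ∉ POS := by
  ext x
  simp only [Finset.mem_image, Finset.mem_filter, Finset.mem_erase, Finset.mem_range]
  constructor
  · rintro ⟨y, hyT, rfl⟩
    have hyI : y ∈ (apFinset (0 : ZMod p) 1 N₁).erase h₀ := by rw [← hV]; exact Finset.mem_union_left _ hyT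
    obtain ⟨hyh, hyI'⟩ := Finset.mem_erase.1 hyI
    refine ⟨⟨fun heq => hyh (ZMod.val_injective p heq), (mem_apFinset_zero_one_iff hN).1 hyI'⟩, fun hmem => ?_⟩
    rw [← hPOS] at hmem
    obtain ⟨y', hy'S, hyy⟩ := Finset.mem_image.1 hmem
    have : y' = y := ZMod.val_injective p hyy
    exact Finset.disjoint_left.1 hTS hyT (this ▸ hy'S)
  · rintro ⟨⟨hne, hlt⟩, hnot⟩
    have hxp : x < p := by omega
    have hxval : (x : ZMod p).val = x := by rw [ZMod.val_natCast, Nat.mod_eq_of_lt hxp]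
    have hxI : (x : ZMod p) ∈ (apFinset (0 : ZMod p) 1 N₁).erase h₀ :=
      Finset.mem_erase.2 ⟨fun h => hne (by rw [← h, hxval]), (mem_apFinset_zero_one_iff hN).2 (by rw [hxval]; exact hlt)⟩
    rw [← hV, Finset.mem_union] at hxI
    rcases hxI with hxT | hxS
    · exact ⟨(x : ZMod p), hxT, hxval⟩
    · exact absurd (by rw [← hPOS]; exact Finset.mem_image.2 ⟨_, hxS, hxval⟩) hnot

end Transport

end Summit.MatrixMultiplication.OmegaCensus.CubeNB
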